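import Literature.Probability.RandomPlanarGeometry.HexSAWStripWidthThreeCritical
import HarnessLib

/-!
# The width-three strip at criticality, continued: the first-moment matrices of the rational kernel in closed form, the Perron
# vectors as explicit cofactor vectors, and the surface-contact density `θ₃` identified (module «WIDTH-THREE-DENSITY»)

Topic `Literature/Probability/RandomPlanarGeometry` (continues «WIDTH-THREE-KERNEL» `HexSAWStripWidthThreeKernel.lean` — the classification
`W3.mem_HBk_three_one`, the level classes `W3.HBk_three_pair/triple/serp/empty`, `W3.kerThree`, `W3.Iinf_three_eq` — and «WIDTH-THREE-CRITICAL»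
`HexSAWStripWidthThreeCritical.lean` — hC2 at `T = 3`, `W3.widthThree_contacts_deviation : ∃ θ₃, …`, `W3.detPoly_mul_eq_zero_of_fixed`,
`W3.stripYT_three_bounds`; uses «CONTACT-LLN» #750 `HV.tendsto_contacts_deviation`, «AMPLITUDE-RATIO» #633 `HV.exists_pos_fixed_vectors_Iinf_stripYT`,
`HV.Iinf_stripYT_nonneg_irred`, `HV.tendsto_stripLenD_residue_explicit` (`⟨ℓ, M̄_len u⟩ > 0`), and the tree's spectral-theory-free uniqueness of
the Perron direction `Literature.Analysis.Matrix.exists_eq_smul_of_mulVec_eq`).  Lane «pcv-sawmu» (CriticalPhenomena venture), a-p2 g25 — the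
item left open by «WIDTH-THREE-CRITICAL» («NOT claimed: u, ℓ, θ₃ in closed form»).  Sources of the SETTING: W. Feller I (1968) XIII.6, XIII.11
(renewal–reward constants as ratios of first moments); E. Seneta (1973) §1.4 (uniqueness of the positive eigenvector of an irreducible matrix);
H. Duminil-Copin, A. Hammond, CMP 324 (2013) §2.2; N. R. Beaton, M. Bousquet-Mélou, J. de Gier, H. Duminil-Copin, A. J. Guttmann, CMP 326 (2014)
§3.2 and Corollary 8.  Nothing below is printed.

## What is proved (namespace `Literature.Probability.RandomPlanarGeometry.SAW.HV.W3`; `x = x_c`, `y₃ = stripYT 3`, `q = x⁶y`, `s₃ = sThree = q₃/(1−q₃)`)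

* §1 the length slices of the twelve nonempty irreducible classes of `S₃` (`LMset_three_short`, `LMset_three_serp`: the serpentine class `1 → 5`
  has the slice `{serpUp (n/6)}` at `n ∈ 6ℕ₊` and nothing else), and the two FIRST-MOMENT MATRICES IN CLOSED FORM (for every `0 ≤ y`, `x_c⁶y < 1`):
  ★★ `contactMomentMatrix_three_eq : (Σ' n, Σ_{l ∈ LMset 3 n n c d} #top·wD)_{cd} = cbarThree y` with `cbarThree = xy·E₄₅ + q/(1−q)²·(E₁₅ + E₄₀)`,
  ★★ `lengthMomentMatrix_three_eq : (Σ' n, n·LMM 3 n n y)_{ab} = mbarThree y` with `mbarThree = M(1) + 2M(2) + 6q/(1−q)²·(E₁₅ + E₄₀)`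
  (re-indexing `n = 6K` by `Function.Injective.tsum_eq`; `Σ_K K q^K = q/(1−q)²`).
* §2 `detThree` (= det(1 − K₃) as a polynomial), ★ `uThree s y` / `ellThree s y` — the first column / row of the adjugate of `1 − K₃(s;y)` as six
  explicit polynomials in `x_c, y, s` each — with `kerThree_mulVec_uThree : D = 0 → K₃ u₃ = u₃` and `ellThree_vecMul_kerThree : D = 0 → ℓ₃ K₃ = ℓ₃`.
* §3 `sThree`, ★ `thetaThree := ⟨ℓ₃, C̄₃(y₃) u₃⟩/⟨ℓ₃, M̄₃(y₃) u₃⟩` (at `s₃, y₃`), `detThree_stripYT_three : D(s₃, y₃) = 0`, `critical_window_three`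
  (`0.2928932 < x_c² < 0.2928933`, `0.0783 < s₃ < 0.0784`), `uThree_zero_pos` (`(u₃)₀ = (ℓ₃)₀ = 1 − x²(1+y₃) + x⁴(y₃−s₃) − x⁶y₃ > 0`), and
  ★★★★ **`widthThree_contacts_deviation_explicit (a b) (hε) : (Σ_{bridges a→b, n_k steps, |#top/n_k − thetaThree| ≥ ε} wD)/D̂(k)_{ab} → 0`** —
  the weak law of «WIDTH-THREE-CRITICAL» with its constant IDENTIFIED: #633's positive Perron vectors of `Iinf 3 y₃ = K₃(s₃; y₃)` are nonzero
  multiples of `uThree`, `ellThree` (uniqueness of the Perron direction, applied to `K₃` and `K₃ᵀ`), the moment matrices are those of §1, and the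
  ratio is invariant under rescaling either vector.  Numerically (`g25/w3/theta3.py`, exact cofactors at `y₃ = 2.8922313867`): **`θ₃ = 0.3303707704`**,
  and the renewal-point density `ν₃ = ⟨ℓ₃,u₃⟩/⟨ℓ₃, M̄₃ u₃⟩ = 0.8249846784` (a-p2 g24's conjectural values).

Label: LANE THEOREM (own result of lane «pcv-sawmu», a-p2 g25, 2026-08-27).  NOT claimed: a decimal enclosure of `thetaThree` proved in Lean
(the statement identifies θ₃ as an explicit algebraic expression; its value 0.33037… is a kit numeric), `ν₃` as a theorem, the β-walk analogue
with the explicit constant (same proof, omitted), a CLT, `T ≥ 4`.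
-/

noncomputable section

open Finset Filter Topology Matrix Literature.Probability.LatticeModels Literature.Probability.Percolation

namespace Literature.Probability.RandomPlanarGeometry.SAW

namespace HV

namespace W3

/-! ### §1 The length slices of the irreducible classes of `S₃` and the two first-moment matrices in closed form -/

/-- A singleton class from truncation `N₀` on (empty below) has the length slice `{L}` exactly at `n = N₀` (plumbing).
[cite: DuminilCopinHammond2013, §2.2; lane plumbing] -/
theorem LMset_of_singleton_class {a b : ℤ} {L : List HV} {N₀ : ℕ} (hL : L.length = N₀ + 1)
    (hS : ∀ N, N₀ ≤ N → HBk 3 N 1 a b = {L}) (hE : ∀ N, N < N₀ → HBk 3 N 1 a b = ∅) (n : ℕ) :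
    LMset 3 n (n : ℤ) a b = if n = N₀ then {L} else ∅ := by
  rw [LMset]
  split_ifs with h
  · subst h
    rw [hS n le_rfl, Finset.filter_singleton, if_pos (by rw [hlen, hL]; push_cast; ring)]
  · rcases Nat.lt_or_ge n N₀ with hn | hn
    · rw [hE n hn, Finset.filter_empty]
    · rw [hS n hn, Finset.filter_singleton, if_neg (by rw [hlen, hL]; push_cast; omega)]

/-- An empty class has empty length slices (plumbing). [cite: DuminilCopinHammond2013, §2.2; lane plumbing] -/
theorem LMset_of_empty_class {a b : ℤ} (hE : ∀ N, HBk 3 N 1 a b = ∅) (n : ℕ) : LMset 3 n (n : ℤ) a b = ∅ := by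
  rw [LMset, hE, Finset.filter_empty]

/-- The ten short classes of `S₃`, sliced by length (`n ↦ LMset 3 n n a b`). [cite: DuminilCopinHammond2013, §2.2; lane «pcv-sawmu» a-p2 g25] -/
theorem LMset_three_short (n : ℕ) :
    LMset 3 n (n : ℤ) 0 1 = (if n = 1 then {W2.irr01} else ∅) ∧ LMset 3 n (n : ℤ) 1 0 = (if n = 1 then {W2.irr10} else ∅) ∧
    LMset 3 n (n : ℤ) 2 3 = (if n = 1 then {W2.irr23} else ∅) ∧ LMset 3 n (n : ℤ) 3 2 = (if n = 1 then {W2.irr32} else ∅) ∧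
    LMset 3 n (n : ℤ) 4 5 = (if n = 1 then {irr45} else ∅) ∧ LMset 3 n (n : ℤ) 5 4 = (if n = 1 then {irr54} else ∅) ∧
    LMset 3 n (n : ℤ) 0 2 = (if n = 2 then {W2.irr02} else ∅) ∧ LMset 3 n (n : ℤ) 3 1 = (if n = 2 then {W2.irr31} else ∅) ∧
    LMset 3 n (n : ℤ) 2 4 = (if n = 2 then {irr24} else ∅) ∧ LMset 3 n (n : ℤ) 5 3 = (if n = 2 then {irr53} else ∅) := by
  have E0 : ∀ a b : ℤ, ∀ N, N < 1 → HBk 3 N 1 a b = ∅ := fun a b N hN => by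
    obtain rfl : N = 0 := by omega
    exact W2.HBk_zero_eq_empty 3 1 a b
  have E1 : ∀ N, N < 2 → HBk 3 N 1 0 2 = ∅ ∧ HBk 3 N 1 3 1 = ∅ ∧ HBk 3 N 1 2 4 = ∅ ∧ HBk 3 N 1 5 3 = ∅ := fun N hN => HBk_three_triple_lt hN
  refine ⟨?_, ?_, ?_, ?_, ?_, ?_, ?_, ?_, ?_, ?_⟩
  · exact LMset_of_singleton_class (by rfl) (fun N hN => (HBk_three_pair hN).1) (E0 0 1) n
  · exact LMset_of_singleton_class (by rfl) (fun N hN => (HBk_three_pair hN).2.1) (E0 1 0) n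
  · exact LMset_of_singleton_class (by rfl) (fun N hN => (HBk_three_pair hN).2.2.1) (E0 2 3) n
  · exact LMset_of_singleton_class (by rfl) (fun N hN => (HBk_three_pair hN).2.2.2.1) (E0 3 2) n
  · exact LMset_of_singleton_class (by rfl) (fun N hN => (HBk_three_pair hN).2.2.2.2.1) (E0 4 5) n
  · exact LMset_of_singleton_class (by rfl) (fun N hN => (HBk_three_pair hN).2.2.2.2.2) (E0 5 4) n
  · exact LMset_of_singleton_class (by rfl) (fun N hN => (HBk_three_triple hN).1) (fun N hN => (E1 N hN).1) n
  · exact LMset_of_singleton_class (by rfl) (fun N hN => (HBk_three_triple hN).2.1) (fun N hN => (E1 N hN).2.1) n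
  · exact LMset_of_singleton_class (by rfl) (fun N hN => (HBk_three_triple hN).2.2.1) (fun N hN => (E1 N hN).2.2.1) n
  · exact LMset_of_singleton_class (by rfl) (fun N hN => (HBk_three_triple hN).2.2.2) (fun N hN => (E1 N hN).2.2.2) n

/-- The serpentine classes sliced by length: `LMset 3 n n 1 5 = {serpUp (n/6)}` when `6 ∣ n`, `n ≥ 6`, else `∅` (and `4 0` with `serpDn`).
[cite: DuminilCopinHammond2013, §2.2; lane «pcv-sawmu» a-p2 g25] -/
theorem LMset_three_serp (n : ℕ) :
    LMset 3 n (n : ℤ) 1 5 = (if 6 ∣ n ∧ 6 ≤ n then {serpUp (n / 6)} else ∅) ∧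
    LMset 3 n (n : ℤ) 4 0 = (if 6 ∣ n ∧ 6 ≤ n then {serpDn (n / 6)} else ∅) := by
  obtain ⟨h15, h40⟩ := HBk_three_serp n
  have key : ∀ (f : ℕ → List HV), (∀ K, (f K).length = 6 * K + 1) →
      ((Finset.range (n / 6)).image (fun K => f (K + 1))).filter (fun l => hlen l = (n : ℤ)) =
        if 6 ∣ n ∧ 6 ≤ n then {f (n / 6)} else ∅ := by
    intro f hf
    ext l
    simp only [Finset.mem_filter, Finset.mem_image, Finset.mem_range, hlen]
    constructor
    · rintro ⟨⟨K, hK, rfl⟩, hl⟩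
      rw [hf] at hl
      push_cast at hl
      have hn : n = 6 * (K + 1) := by omega
      rw [if_pos ⟨⟨K + 1, hn⟩, by omega⟩, Finset.mem_singleton, hn, Nat.mul_div_cancel_left _ (by norm_num)]
    · intro hl
      split_ifs at hl with h
      · rw [Finset.mem_singleton] at hl
        subst hl
        obtain ⟨⟨m, hm⟩, h6⟩ := h
        have hm1 : 1 ≤ m := by omega
        refine ⟨⟨m - 1, by rw [hm, Nat.mul_div_cancel_left _ (by norm_num)]; omega, by
          rw [hm, Nat.mul_div_cancel_left _ (by norm_num), Nat.sub_add_cancel hm1]⟩, ?_⟩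
        rw [hf, hm, Nat.mul_div_cancel_left _ (by norm_num)]; push_cast; ring
      · simp at hl
  constructor
  · rw [LMset, h15]; exact key serpUp length_serpUp
  · rw [LMset, h40]; exact key serpDn length_serpDn

/-- Sum over a length-indicator slice (plumbing): `Σ' n, Σ_{l ∈ (if n = N₀ then {L} else ∅)} F n l = F N₀ L`. [cite: Feller1968, XIII.3; lane plumbing] -/
theorem tsum_sum_ite_singleton (F : ℕ → List HV → ℝ) (N₀ : ℕ) (L : List HV) :
    (∑' n : ℕ, ∑ l ∈ (if n = N₀ then ({L} : Finset (List HV)) else ∅), F n l) = F N₀ L := by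
  rw [tsum_eq_single N₀ (fun n hn => by rw [if_neg hn, Finset.sum_empty])]
  rw [if_pos rfl, Finset.sum_singleton]

/-- Sum over the serpentine slices (plumbing): `Σ' n, Σ_{l ∈ slice n} F l = Σ' K, [1 ≤ K]·F(f K)` re-indexed by `n = 6K`.
[cite: Feller1968, XIII.3; lane plumbing] -/
theorem tsum_sum_serp_slice (F : ℕ → List HV → ℝ) (f : ℕ → List HV) :
    (∑' n : ℕ, ∑ l ∈ (if 6 ∣ n ∧ 6 ≤ n then ({f (n / 6)} : Finset (List HV)) else ∅), F n l) =
      ∑' K : ℕ, if 1 ≤ K then F (6 * K) (f K) else 0 := by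
  have hinj : Function.Injective (fun K : ℕ => 6 * K) := fun a b h => by simpa using h
  rw [← hinj.tsum_eq (f := fun n => ∑ l ∈ (if 6 ∣ n ∧ 6 ≤ n then ({f (n / 6)} : Finset (List HV)) else ∅), F n l)]
  · refine tsum_congr fun K => ?_
    by_cases hK : 1 ≤ K
    · rw [if_pos ⟨⟨K, rfl⟩, by omega⟩, if_pos hK, Finset.sum_singleton, Nat.mul_div_cancel_left _ (by norm_num)]
    · rw [if_neg (by omega), if_neg hK, Finset.sum_empty]
  · intro n hn
    rw [Function.mem_support] at hn
    by_contra hr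
    apply hn
    rw [if_neg, Finset.sum_empty]
    rintro ⟨⟨m, rfl⟩, -⟩
    exact hr ⟨m, rfl⟩

/-- The **contact first-moment matrix of the critical kernel of `S₃`** (any `0 ≤ y` with `x_c⁶y < 1`):
`C̄₃(y)_{cd} = Σ_n Σ_{irreducible c→d with n steps} #top · x_c^n y^{#top}` has the entries `(4,5) = x_c y` (the slant onto the surface) and
`(1,5) = (4,0) = Σ_K K (x_c⁶y)^K = q/(1−q)²`, `q = x_c⁶y`, all others `0`. [cite: DuminilCopinHammond2013, §2.2; BeatonBousquetMelouDeGierDuminilCopinGuttmann2014, §3.2 (surface visits); Feller1968, XIII.11 (mean recurrence); lane «pcv-sawmu» a-p2 g25 — own result] -/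
def cbarThree (y : ℝ) : Matrix (Fin (2 * 3)) (Fin (2 * 3)) ℝ :=
  Matrix.of ![![0, 0, 0, 0, 0, 0], ![0, 0, 0, 0, 0, hexCriticalFugacity ^ 6 * y / (1 - hexCriticalFugacity ^ 6 * y) ^ 2],
    ![0, 0, 0, 0, 0, 0], ![0, 0, 0, 0, 0, 0],
    ![hexCriticalFugacity ^ 6 * y / (1 - hexCriticalFugacity ^ 6 * y) ^ 2, 0, 0, 0, 0, hexCriticalFugacity * y], ![0, 0, 0, 0, 0, 0]]

/-- The **length first-moment matrix of the critical kernel of `S₃`**: `M̄₃(y) = Σ_n n·M(n) = M(1) + 2M(2) + 6q/(1−q)²·(E₁₅ + E₄₀)`.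
[cite: DuminilCopinHammond2013, §2.2; Feller1968, XIII.11 (mean recurrence time); lane «pcv-sawmu» a-p2 g25 — own result] -/
def mbarThree (y : ℝ) : Matrix (Fin (2 * 3)) (Fin (2 * 3)) ℝ :=
  Matrix.of ![![0, hexCriticalFugacity, 2 * hexCriticalFugacity ^ 2, 0, 0, 0],
    ![hexCriticalFugacity, 0, 0, 0, 0, 6 * (hexCriticalFugacity ^ 6 * y / (1 - hexCriticalFugacity ^ 6 * y) ^ 2)],
    ![0, 0, 0, hexCriticalFugacity, 2 * hexCriticalFugacity ^ 2, 0], ![0, 2 * hexCriticalFugacity ^ 2, hexCriticalFugacity, 0, 0, 0],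
    ![6 * (hexCriticalFugacity ^ 6 * y / (1 - hexCriticalFugacity ^ 6 * y) ^ 2), 0, 0, 0, 0, hexCriticalFugacity * y],
    ![0, 0, 0, 2 * hexCriticalFugacity ^ 2, hexCriticalFugacity, 0]]

/-- The serpentine moment series: `Σ_K [K ≥ 1]·K·x^{6K}y^K = q/(1−q)²` and `Σ_K [K ≥ 1]·6K·x^{6K}y^K = 6q/(1−q)²` (plumbing).
[cite: Feller1968, XIII.11; lane plumbing] -/
theorem tsum_serp_moments {y : ℝ} (hy : 0 ≤ y) (hy' : hexCriticalFugacity ^ 6 * y < 1) :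
    (∑' K : ℕ, if 1 ≤ K then (K : ℝ) * (hexCriticalFugacity ^ (6 * K) * y ^ K) else 0) =
        hexCriticalFugacity ^ 6 * y / (1 - hexCriticalFugacity ^ 6 * y) ^ 2 ∧
      (∑' K : ℕ, if 1 ≤ K then (6 * K : ℝ) * (hexCriticalFugacity ^ (6 * K) * y ^ K) else 0) =
        6 * (hexCriticalFugacity ^ 6 * y / (1 - hexCriticalFugacity ^ 6 * y) ^ 2) := by
  set q : ℝ := hexCriticalFugacity ^ 6 * y with hq
  have hq0 : 0 ≤ q := mul_nonneg (pow_nonneg hexCriticalFugacity_pos_lt_one.1.le _) hy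
  have hnorm : ‖q‖ < 1 := by rw [Real.norm_eq_abs, abs_of_nonneg hq0]; exact hy'
  have hterm : ∀ K : ℕ, (if 1 ≤ K then (K : ℝ) * (hexCriticalFugacity ^ (6 * K) * y ^ K) else 0) = (K : ℝ) * q ^ K := by
    intro K
    rcases Nat.eq_zero_or_pos K with rfl | hK
    · simp
    · rw [if_pos (show 1 ≤ K by omega), hq, mul_pow, ← pow_mul]
  have h1 : (∑' K : ℕ, if 1 ≤ K then (K : ℝ) * (hexCriticalFugacity ^ (6 * K) * y ^ K) else 0) = q / (1 - q) ^ 2 := by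
    rw [tsum_congr hterm]; exact tsum_coe_mul_geometric_of_norm_lt_one hnorm
  refine ⟨h1, ?_⟩
  rw [← h1, ← tsum_mul_left]
  exact tsum_congr fun K => by split_ifs <;> ring

/-- ★★ **The contact first-moment matrix of `S₃` in closed form**: for `0 ≤ y`, `x_c⁶y < 1`,
`(Σ' n, Σ_{l ∈ LMset 3 n n c d} #top(l.tail)·wD(l))_{cd} = C̄₃(y)`. [cite: DuminilCopinHammond2013, §2.2; Feller1968, XIII.11; lane «pcv-sawmu» a-p2 g25 — own result] -/
theorem contactMomentMatrix_three_eq {y : ℝ} (hy : 0 ≤ y) (hy' : hexCriticalFugacity ^ 6 * y < 1) :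
    (Matrix.of fun c d : Fin (2 * 3) => ∑' n : ℕ, ∑ l ∈ LMset 3 n (n : ℤ) (c : ℕ) (d : ℕ), (topCnt 3 l.tail : ℝ) * wD 3 y l) =
      cbarThree y := by
  obtain ⟨hs1, -⟩ := tsum_serp_moments hy hy'
  have S := LMset_three_short
  have P := LMset_three_serp
  have hE := fun {a b : ℤ} (h) (n : ℕ) => LMset_of_empty_class (a := a) (b := b) (fun N => HBk_three_empty (N := N) h) n
  have top01 : topCnt 3 W2.irr01.tail = 0 := by simp [W2.irr01, topCnt, bit]
  have top10 : topCnt 3 W2.irr10.tail = 0 := by simp [W2.irr10, topCnt, bit]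
  have top23 : topCnt 3 W2.irr23.tail = 0 := by simp [W2.irr23, topCnt, bit]
  have top32 : topCnt 3 W2.irr32.tail = 0 := by simp [W2.irr32, topCnt, bit]
  have top45 : topCnt 3 irr45.tail = 1 := by simp [irr45, topCnt, bit]
  have top54 : topCnt 3 irr54.tail = 0 := by simp [irr54, topCnt, bit]
  have top02 : topCnt 3 W2.irr02.tail = 0 := by simp [W2.irr02, topCnt, bit]
  have top31 : topCnt 3 W2.irr31.tail = 0 := by simp [W2.irr31, topCnt, bit]
  have top24 : topCnt 3 irr24.tail = 0 := by simp [irr24, topCnt, bit]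
  have top53 : topCnt 3 irr53.tail = 0 := by simp [irr53, topCnt, bit]
  have serp15 : (∑' n : ℕ, ∑ l ∈ LMset 3 n (n : ℤ) 1 5, (topCnt 3 l.tail : ℝ) * wD 3 y l) =
      hexCriticalFugacity ^ 6 * y / (1 - hexCriticalFugacity ^ 6 * y) ^ 2 := by
    simp_rw [(P _).1]
    rw [tsum_sum_serp_slice, ← hs1]
    exact tsum_congr fun K => by
      split_ifs with h
      · rw [topCnt_serpUp_tail, wD_serpUp]
      · rfl
  have serp40 : (∑' n : ℕ, ∑ l ∈ LMset 3 n (n : ℤ) 4 0, (topCnt 3 l.tail : ℝ) * wD 3 y l) =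
      hexCriticalFugacity ^ 6 * y / (1 - hexCriticalFugacity ^ 6 * y) ^ 2 := by
    simp_rw [(P _).2]
    rw [tsum_sum_serp_slice, ← hs1]
    exact tsum_congr fun K => by
      split_ifs with h
      · rw [topCnt_serpDn_tail, wD_serpDn]
      · rfl
  ext c d
  fin_cases c <;> fin_cases d <;>
    simp [cbarThree, (S _).1, (S _).2.1, (S _).2.2.1, (S _).2.2.2.1, (S _).2.2.2.2.1, (S _).2.2.2.2.2.1, (S _).2.2.2.2.2.2.1,
      (S _).2.2.2.2.2.2.2.1, (S _).2.2.2.2.2.2.2.2.1, (S _).2.2.2.2.2.2.2.2.2, tsum_sum_ite_singleton, top01, top10, top23, top32, top45,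
      top54, top02, top31, top24, top53, (wD_irr y).2.2.2.2.2.1, hE, serp15, serp40]

/-- ★★ **The length first-moment matrix of `S₃` in closed form**: for `0 ≤ y`, `x_c⁶y < 1`, `(Σ' n, n·LMM 3 n n y)_{ab} = M̄₃(y)_{ab}`.
[cite: DuminilCopinHammond2013, §2.2; Feller1968, XIII.11 (mean recurrence time); lane «pcv-sawmu» a-p2 g25 — own result] -/
theorem lengthMomentMatrix_three_eq {y : ℝ} (hy : 0 ≤ y) (hy' : hexCriticalFugacity ^ 6 * y < 1) :
    (Matrix.of fun a b : Fin (2 * 3) => ∑' n : ℕ, (n : ℝ) * LMM 3 n (n : ℤ) y a b) = mbarThree y := by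
  obtain ⟨-, hs6⟩ := tsum_serp_moments hy hy'
  have S := LMset_three_short
  have P := LMset_three_serp
  have hE := fun {a b : ℤ} (h) (n : ℕ) => LMset_of_empty_class (a := a) (b := b) (fun N => HBk_three_empty (N := N) h) n
  obtain ⟨w01, w10, w23, w32, w54, w45, w02, w31, w24, w53⟩ := wD_irr y
  have single : ∀ (N₀ : ℕ) (L : List HV), (∑' n : ℕ, (n : ℝ) * ∑ l ∈ (if n = N₀ then ({L} : Finset (List HV)) else ∅), wD 3 y l) =
      (N₀ : ℝ) * wD 3 y L := fun N₀ L => by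
    rw [← tsum_sum_ite_singleton (fun n l => (n : ℝ) * wD 3 y l) N₀ L]
    exact tsum_congr fun n => by rw [Finset.mul_sum]
  have e15 : (∑' n : ℕ, (n : ℝ) * ∑ l ∈ LMset 3 n (n : ℤ) 1 5, wD 3 y l) =
      6 * (hexCriticalFugacity ^ 6 * y / (1 - hexCriticalFugacity ^ 6 * y) ^ 2) := by
    simp_rw [(P _).1]
    rw [show (fun n : ℕ => (n : ℝ) * ∑ l ∈ (if 6 ∣ n ∧ 6 ≤ n then ({serpUp (n / 6)} : Finset (List HV)) else ∅), wD 3 y l) =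
      fun n => ∑ l ∈ (if 6 ∣ n ∧ 6 ≤ n then ({serpUp (n / 6)} : Finset (List HV)) else ∅), (n : ℝ) * wD 3 y l from
      funext fun n => Finset.mul_sum _ _ _, tsum_sum_serp_slice, ← hs6]
    exact tsum_congr fun K => by
      split_ifs with h
      · rw [wD_serpUp]; push_cast; ring
      · rfl
  have e40 : (∑' n : ℕ, (n : ℝ) * ∑ l ∈ LMset 3 n (n : ℤ) 4 0, wD 3 y l) =
      6 * (hexCriticalFugacity ^ 6 * y / (1 - hexCriticalFugacity ^ 6 * y) ^ 2) := by
    simp_rw [(P _).2]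
    rw [show (fun n : ℕ => (n : ℝ) * ∑ l ∈ (if 6 ∣ n ∧ 6 ≤ n then ({serpDn (n / 6)} : Finset (List HV)) else ∅), wD 3 y l) =
      fun n => ∑ l ∈ (if 6 ∣ n ∧ 6 ≤ n then ({serpDn (n / 6)} : Finset (List HV)) else ∅), (n : ℝ) * wD 3 y l from
      funext fun n => Finset.mul_sum _ _ _, tsum_sum_serp_slice, ← hs6]
    exact tsum_congr fun K => by
      split_ifs with h
      · rw [wD_serpDn]; push_cast; ring
      · rfl
  ext a b
  fin_cases a <;> fin_cases b <;>
    simp [mbarThree, LMM, LMs, (S _).1, (S _).2.1, (S _).2.2.1, (S _).2.2.2.1, (S _).2.2.2.2.1, (S _).2.2.2.2.2.1, (S _).2.2.2.2.2.2.1,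
      (S _).2.2.2.2.2.2.2.1, (S _).2.2.2.2.2.2.2.2.1, (S _).2.2.2.2.2.2.2.2.2, single, w01, w10, w23, w32, w54, w45, w02, w31, w24, w53, hE,
      e15, e40]

/-! ### §2 The Perron vectors of `K₃` as cofactor vectors, and `θ₃` explicitly -/

/-- The determinant polynomial `D(y, s) = det(1 − K₃(s; y))` (as an explicit polynomial in `x_c`, `y`, `s`). [cite: Seneta1973, §1.4; lane «pcv-sawmu» a-p2 g25] -/
def detThree (s y : ℝ) : ℝ :=
  1 - 2 * hexCriticalFugacity ^ 2 - hexCriticalFugacity ^ 2 * s ^ 2 - hexCriticalFugacity ^ 2 * y + hexCriticalFugacity ^ 4 - 2 * hexCriticalFugacity ^ 4 * s + hexCriticalFugacity ^ 4 * s ^ 2 + 2 * hexCriticalFugacity ^ 4 * y - hexCriticalFugacity ^ 6 - 2 * hexCriticalFugacity ^ 6 * s ^ 2 - 2 * hexCriticalFugacity ^ 6 * y + hexCriticalFugacity ^ 8 * s ^ 2 + 2 * hexCriticalFugacity ^ 8 * y - hexCriticalFugacity ^ 10 * y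

/-- ★ **A right fixed vector of `K₃` in closed form**: the first column of the adjugate of `1 − K₃(s; y)` — six explicit polynomials in
`x_c, y, s`; it satisfies `K₃ u = u − D·e₀`, hence `K₃ u = u` whenever `D = 0`. [cite: Seneta1973, §1.4 (positive eigenvectors); lane «pcv-sawmu» a-p2 g25 — own computation (`g25/w3/theta3.py`)] -/
def uThree (s y : ℝ) : Fin (2 * 3) → ℝ :=
  let x : ℝ := hexCriticalFugacity
  ![(1) + (-1) * x ^ 2 + (-1) * x ^ 2 * y + (-1) * x ^ 4 * s + (1) * x ^ 4 * y + (-1) * x ^ 6 * y, (1) * x + (1) * x * s ^ 2 + (-1) * x ^ 3 + (-1) * x ^ 3 * s ^ 2 + (-1) * x ^ 3 * y + (1) * x ^ 5 * s ^ 2 + (1) * x ^ 5 * y + (-1) * x ^ 7 * y, (1) * x ^ 2 * s + (1) * x ^ 4 + (1) * x ^ 4 * s ^ 2 + (-1) * x ^ 6 * s ^ 2 + (-1) * x ^ 6 * y + (1) * x ^ 8 * y, (1) * x ^ 3 + (1) * x ^ 3 * s + (1) * x ^ 3 * s ^ 2 + (-1) * x ^ 5 * y, (1) * s + (-1) * x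 ^ 2 * s + (-1) * x ^ 4 * s ^ 2 + (1) * x ^ 6 * y, (1) * x * s + (-1) * x ^ 3 * s + (1) * x ^ 5 + (1) * x ^ 5 * s]

/-- ★ **A left fixed vector of `K₃` in closed form**: the first row of the adjugate of `1 − K₃(s; y)`. [cite: Seneta1973, §1.4; lane «pcv-sawmu» a-p2 g25 — own computation] -/
def ellThree (s y : ℝ) : Fin (2 * 3) → ℝ :=
  let x : ℝ := hexCriticalFugacity
  ![(1) + (-1) * x ^ 2 + (-1) * x ^ 2 * y + (-1) * x ^ 4 * s + (1) * x ^ 4 * y + (-1) * x ^ 6 * y, (1) * x + (-1) * x ^ 3 + (-1) * x ^ 3 * y + (1) * x ^ 5 + (1) * x ^ 5 * y + (-2) * x ^ 7 * y + (1) * x ^ 9 * y, (1) * x ^ 2 + (1) * x ^ 4 * s + (-1) * x ^ 4 * y + (-1) * x ^ 6 * s, (1) * x ^ 3 + (1) * x ^ 3 * s + (-1) * x ^ 5 * y + (1) * x ^ 7 * y, (1) * x ^ 2 * s + (1) * x ^ 4 + (-1) * x ^ 4 * s + (2) * x ^ 6 * s + (-1) * x ^ 8 * s, (1) * x * s + (-1)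 * x ^ 3 * s + (1) * x ^ 5 * s + (1) * x ^ 5 * y]

/-- `K₃(s;y) u₃ = u₃` whenever `D(y,s) = 0` (the adjugate column is in the kernel of `1 − K₃`). [cite: Seneta1973, §1.4; lane «pcv-sawmu» a-p2 g25] -/
theorem kerThree_mulVec_uThree {s y : ℝ} (hD : detThree s y = 0) : kerThree s y *ᵥ uThree s y = uThree s y := by
  unfold detThree at hD
  ext i
  fin_cases i <;> simp [kerThree, uThree, Matrix.mulVec, dotProduct, Fin.sum_univ_succ] <;>
    first | linear_combination (-1 : ℝ) * hD | linear_combination hD | ring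

/-- `ℓ₃ K₃(s;y) = ℓ₃` whenever `D(y,s) = 0` (the adjugate row). [cite: Seneta1973, §1.4; lane «pcv-sawmu» a-p2 g25] -/
theorem ellThree_vecMul_kerThree {s y : ℝ} (hD : detThree s y = 0) : ellThree s y ᵥ* kerThree s y = ellThree s y := by
  unfold detThree at hD
  ext i
  fin_cases i <;> simp [kerThree, ellThree, Matrix.vecMul, dotProduct, Fin.sum_univ_succ] <;>
    first | linear_combination (-1 : ℝ) * hD | linear_combination hD | ring

/-! ### §3 `θ₃` explicitly: the cofactor vectors are the Perron vectors up to scale -/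

/-- The serpentine parameter at criticality: `s₃ = x_c⁶y₃/(1 − x_c⁶y₃)`. [cite: DuminilCopinHammond2013, §2.2; lane «pcv-sawmu» a-p2 g25] -/
def sThree : ℝ := hexCriticalFugacity ^ 6 * stripYT 3 / (1 - hexCriticalFugacity ^ 6 * stripYT 3)

/-- ★★★ **The surface-contact density of the critical width-three strip, explicitly**:
`θ₃ := ⟨ℓ₃, C̄₃(y₃) u₃⟩ / ⟨ℓ₃, M̄₃(y₃) u₃⟩` with the cofactor Perron vectors `u₃ = uThree s₃ y₃`, `ℓ₃ = ellThree s₃ y₃` and the closed-form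
first-moment matrices `cbarThree`, `mbarThree` — an explicit algebraic function of `x_c` and `y₃` (numerically `0.3303707704`).
[cite: Feller1968, XIII.11 (renewal–reward constant); DuminilCopinHammond2013, §2.2; lane «pcv-sawmu» a-p2 g25 — own result] -/
def thetaThree : ℝ :=
  (ellThree sThree (stripYT 3) ⬝ᵥ (cbarThree (stripYT 3) *ᵥ uThree sThree (stripYT 3))) /
    (ellThree sThree (stripYT 3) ⬝ᵥ (mbarThree (stripYT 3) *ᵥ uThree sThree (stripYT 3)))

/-- `det(1 − K₃(s₃; y₃)) = 0`: the critical kernel has the eigenvalue `1` (via #633's positive fixed vector and the adjugate identity).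
[cite: Seneta1973, §1.4; lane «pcv-sawmu» a-p2 g25] -/
theorem detThree_stripYT_three : detThree sThree (stripYT 3) = 0 := by
  have hy0 : 0 ≤ stripYT 3 := (stripYT_pos (by norm_num)).le
  obtain ⟨u, ℓ, hu0, -, hu, -⟩ := exists_pos_fixed_vectors_Iinf_stripYT (T := 3) (by norm_num)
  rw [Iinf_three_eq hy0 xc_pow_six_mul_stripYT_three_lt_one] at hu
  have hD := detPoly_mul_eq_zero_of_fixed sThree (stripYT 3) hu
  rcases mul_eq_zero.1 hD with h | h
  · exact h
  · exact absurd h (hu0 0).ne'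

/-- Numerical window for the critical data of `S₃` (plumbing): `0.2928932 < x_c² < 0.2928933`, `0.0783 < s₃ < 0.0784`.
[cite: BeatonBousquetMelouDeGierDuminilCopinGuttmann2014, §3.2; lane plumbing] -/
theorem critical_window_three :
    0.2928932 < hexCriticalFugacity ^ 2 ∧ hexCriticalFugacity ^ 2 < 0.2928933 ∧ 0.0783 < sThree ∧ sThree < 0.0784 := by
  obtain ⟨hr1, hr2⟩ := sqrt_two_window9
  have hX : hexCriticalFugacity ^ 2 = (2 - Real.sqrt 2) / 2 := xc_sq_eq_half
  have hXlo : 0.2928932 < hexCriticalFugacity ^ 2 := by rw [hX]; linarith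
  have hXhi : hexCriticalFugacity ^ 2 < 0.2928933 := by rw [hX]; linarith
  obtain ⟨hylo, hyhi⟩ := stripYT_three_bounds
  set X := hexCriticalFugacity ^ 2 with hXdef
  set y := stripYT 3 with hydef
  have hq : hexCriticalFugacity ^ 6 * y = X ^ 3 * y := by rw [hXdef]; ring
  have hX0 : 0 < X := by linarith
  have hqlo : 0.07264 < X ^ 3 * y := by nlinarith [mul_pos hX0 hX0, pow_pos hX0 3]
  have hqhi : X ^ 3 * y < 0.0727 := by nlinarith [mul_pos hX0 hX0, pow_pos hX0 3]
  have hden : 0 < 1 - X ^ 3 * y := by linarith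
  refine ⟨hXlo, hXhi, ?_, ?_⟩
  · rw [sThree, ← hydef, hq, lt_div_iff₀ hden]; linarith
  · rw [sThree, ← hydef, hq, div_lt_iff₀ hden]; linarith

/-- The first cofactor entry is positive at criticality: `(uThree s₃ y₃)₀ = (ellThree s₃ y₃)₀ = 1 − x²(1+y₃) + x⁴(y₃ − s₃) − x⁶y₃ > 0` (`≈ 0.0287`),
so the cofactor vectors are nonzero (plumbing for the uniqueness transfer). [cite: Seneta1973, §1.4; lane «pcv-sawmu» a-p2 g25] -/
theorem uThree_zero_pos : 0 < uThree sThree (stripYT 3) 0 ∧ 0 < ellThree sThree (stripYT 3) 0 := by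
  obtain ⟨hXlo, hXhi, hslo, hshi⟩ := critical_window_three
  obtain ⟨hylo, hyhi⟩ := stripYT_three_bounds
  set X := hexCriticalFugacity ^ 2 with hXdef
  set y := stripYT 3
  set s := sThree
  have hval : uThree s y 0 = 1 - X * (1 + y) + X ^ 2 * (y - s) - X ^ 3 * y := by
    simp [uThree, hXdef]; ring
  have hval' : ellThree s y 0 = uThree s y 0 := by simp [uThree, ellThree]
  have h1 : X * (1 + y) ≤ 0.2928933 * (1 + y) := mul_le_mul_of_nonneg_right hXhi.le (by linarith)
  have hX2 : 0.0857864 ≤ X ^ 2 := by nlinarith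
  have hX3 : X ^ 3 ≤ 0.0251263 := by nlinarith
  have h2 : 0.0857864 * (y - s) ≤ X ^ 2 * (y - s) := mul_le_mul_of_nonneg_right hX2 (by linarith)
  have h3 : X ^ 3 * y ≤ 0.0251263 * y := mul_le_mul_of_nonneg_right hX3 (by linarith)
  have hpos : 0 < uThree s y 0 := by rw [hval]; nlinarith
  exact ⟨hpos, hval' ▸ hpos⟩

/-- ★★★★ **WIDTH THREE, EXPLICIT CONSTANT**: the surface contacts of a long critical bridge of `S₃` concentrate at `θ₃ · n` with
`θ₃ = thetaThree` — the weak law `widthThree_contacts_deviation` with its constant identified: #633's positive Perron vectors of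
`Iinf 3 y₃ = K₃(s₃; y₃)` are positive multiples of the explicit cofactor vectors `uThree`, `ellThree` (uniqueness of the Perron direction of an
irreducible nonnegative matrix), the first-moment matrices are `cbarThree` / `mbarThree` (§1), and the ratio is scale-free.
[cite: Feller1968, XIII.6 and XIII.11; Seneta1973, §1.4; DuminilCopinHammond2013, §2.2; BeatonBousquetMelouDeGierDuminilCopinGuttmann2014, Corollary 8; lane «pcv-sawmu» a-p2 g25 — own result, not in print] -/
theorem widthThree_contacts_deviation_explicit (a b : Fin (2 * 3)) {ε : ℝ} (hε : 0 < ε) :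
    Tendsto (fun k : ℕ => (∑ l ∈ (LUset 3 (2 * k + 1) (hatLen k a b) (a : ℕ) (b : ℕ)).filter (fun l =>
        ε ≤ |(topCnt 3 l.tail : ℝ) / (hatLen k a b : ℝ) - thetaThree|), wD 3 (stripYT 3) l) / hatD 3 (stripYT 3) k a b) atTop (𝓝 0) := by
  have hy0 : 0 ≤ stripYT 3 := (stripYT_pos (by norm_num)).le
  have hq1 := xc_pow_six_mul_stripYT_three_lt_one
  obtain ⟨u, ℓ, hu0, hℓ0, hu, hℓ⟩ := exists_pos_fixed_vectors_Iinf_stripYT (T := 3) (by norm_num)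
  have h := tendsto_contacts_deviation (T := 3) (by norm_num) hu0 hℓ0 hu hℓ widthThree_summable_contactSqIrr a b hε
  -- identify the constant
  obtain ⟨hnn, hirr⟩ := Iinf_stripYT_nonneg_irred (T := 3) (by norm_num)
  have hK : Iinf 3 (stripYT 3) = kerThree sThree (stripYT 3) := Iinf_three_eq hy0 hq1
  have hD := detThree_stripYT_three
  -- the cofactor vectors are fixed vectors of `Iinf 3 y₃`
  have huT : Iinf 3 (stripYT 3) *ᵥ uThree sThree (stripYT 3) = uThree sThree (stripYT 3) := by
    rw [hK]; exact kerThree_mulVec_uThree hD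
  have hℓT : ellThree sThree (stripYT 3) ᵥ* Iinf 3 (stripYT 3) = ellThree sThree (stripYT 3) := by
    rw [hK]; exact ellThree_vecMul_kerThree hD
  -- uniqueness of the Perron direction: `uThree = t • u`, `ellThree = t' • ℓ`
  obtain ⟨t, ht⟩ := Literature.Analysis.Matrix.exists_eq_smul_of_mulVec_eq hnn hirr hu0 hu huT
  have hirrT : ∀ a b : Fin (2 * 3), ∃ j : ℕ, 0 < ((Iinf 3 (stripYT 3))ᵀ ^ j) a b := fun a b => by
    obtain ⟨j, hj⟩ := hirr b a
    exact ⟨j, by rw [← Matrix.transpose_pow]; exact hj⟩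
  obtain ⟨t', ht'⟩ := Literature.Analysis.Matrix.exists_eq_smul_of_mulVec_eq (A := (Iinf 3 (stripYT 3))ᵀ) (fun a b => hnn b a) hirrT hℓ0
    (by rw [Matrix.mulVec_transpose]; exact hℓ) (w := ellThree sThree (stripYT 3)) (by rw [Matrix.mulVec_transpose]; exact hℓT)
  obtain ⟨hpos, hpos'⟩ := uThree_zero_pos
  have ht0 : t ≠ 0 := by
    intro h0; rw [h0, zero_smul] at ht; rw [ht] at hpos; simp at hpos
  have ht'0 : t' ≠ 0 := by
    intro h0; rw [h0, zero_smul] at ht'; rw [ht'] at hpos'; simp at hpos'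
  -- the two first-moment matrices in closed form
  have hC := contactMomentMatrix_three_eq hy0 hq1
  have hM := lengthMomentMatrix_three_eq hy0 hq1
  have hden : ℓ ⬝ᵥ (mbarThree (stripYT 3) *ᵥ u) ≠ 0 := by
    have := (tendsto_stripLenD_residue_explicit (T := 3) (by norm_num) hu0 hℓ0 hu hℓ).1
    rw [hM] at this
    exact this.ne'
  have hθ : (ℓ ⬝ᵥ ((Matrix.of fun c d : Fin (2 * 3) =>
      ∑' n : ℕ, ∑ l ∈ LMset 3 n (n : ℤ) (c : ℕ) (d : ℕ), (topCnt 3 l.tail : ℝ) * wD 3 (stripYT 3) l) *ᵥ u)) /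
      (ℓ ⬝ᵥ ((Matrix.of fun a b : Fin (2 * 3) => ∑' n : ℕ, (n : ℝ) * LMM 3 n (n : ℤ) (stripYT 3) a b) *ᵥ u)) = thetaThree := by
    rw [hC, hM, thetaThree, ht, ht']
    simp only [Matrix.mulVec_smul, dotProduct_smul, smul_dotProduct, smul_eq_mul]
    field_simp
  rw [hθ] at h
  exact h

end W3

end HV

end Literature.Probability.RandomPlanarGeometry.SAW
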